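/-
Copyright (c) 2026 the pub-hodgecm-mathlib formalisation cell (harness21).  Prover seat hodgecm-mathlib-K2Liu-p01 (g2): Track B «K2-LIT»,
#184♮ = hLiu418 = stmt-HodgeConjecture-24832; LEAD F0P6-plan (g10) «M-154t» (3) / GATE (c2) 2026-09-04T00:02:05Z: the c1 helper for PACKAGE (B).
-/
import Literature.NumberTheory.Automorphic.IdeleClassCharacterConjugate        -- ★ `galConj`, `isConjugateSelfDual_iff_galConj_eq_inv`, `IsConjugateSymplectic.galConj`, `HasWeight.galConj_complexConj`
import Literature.NumberTheory.Automorphic.QuadraticIdelicNormLocalNorms       -- ★ `IsConjugateSymplectic.isConjugateSelfDual`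
import HarnessLib

/-!
# Crux `HLiu418`, road `K2_Liu`: the inverse of a conjugate-symplectic character is conjugate symplectic, of the same weight

Cell `hodgecm-mathlib`, crux item hLiu418 = `stmt-HodgeConjecture-24832`; squad K2 ∕ K2Liu; prover K2Liu-p01 (g2).  THEOREMS ONLY
(no `def`, no instance, no notation, no named-fact hypothesis, no `sorry`); lane `--supports stmt-HodgeConjecture-24832`.
LEAD «M-154t» PACKAGE (B): the hypothesis-side character of the K2_Liu seam becomes `lam⁻¹`; this file discharges the binder
`(hlam' : IsConjugateSymplectic L lam⁻¹)` (and the weight of `lam⁻¹`) from `hlam : IsConjugateSymplectic L lam`: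
* `galConj_complexConj_eq_inv` — for conjugate-symplectic `ψ`: `ψ^c = ψ⁻¹` ([Liu2021, Def. 4.1]: conjugate self-dual ⇔ `ψ[ȳ] = ψ[y]⁻¹`;
  ★ `IsConjugateSymplectic.isConjugateSelfDual`, ★ `isConjugateSelfDual_iff_galConj_eq_inv`);
* `IsConjugateSymplectic.inv` — `ψ⁻¹` is conjugate symplectic ([Liu2021, Rem. 4.4] «`μ^c` is conjugate symplectic», ★ `IsConjugateSymplectic.galConj`);
* `HasWeight.inv` — `ψ⁻¹` has the SAME weight `𝔴` (the tree's ★ `HasWeight` is the absolute weight `|e_w|`; ★ `HasWeight.galConj_complexConj`);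
  in particular `HasWeight L lam⁻¹ 1` for a weight-one `lam` — no «weight −1» token is needed anywhere.
HONEST LABEL.  Count-neutral helper; it retires nothing by itself: `HC_CM` is proved only modulo the 7 printed citations (2 remaining named inputs:
hLiu418 = `stmt-HodgeConjecture-24832`, h413 = `stmt-HodgeConjecture-24833`) until rung 0 closes.

## References
* [Liu2021] Y. Liu, *Fourier–Jacobi cycles and arithmetic relative trace formula*, Camb. J. Math. 9 (2021): Def. 4.1, Def. 4.3, Remark 4.4.
-/

set_option autoImplicit false
set_option linter.dupNamespace false -- the mandated namespace repeats `HodgeConjecture.HodgeConjecture`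

noncomputable section

open NumberField
open Literature.NumberTheory.Automorphic Literature.NumberTheory.Automorphic.IdeleClassGroup

namespace Summit.HodgeConjecture.HodgeConjecture.Cruxes.HLiu418.K2LiuConjugateSymplecticInv

variable {L : Type} [Field L] [NumberField L] [IsCMField L]

/-- **`ψ^c = ψ⁻¹` for a conjugate-symplectic `ψ`** (conjugate symplectic ⇒ conjugate self-dual ⇔ `ψ[ȳ] = ψ[y]⁻¹`). [cite: Liu2021, Def. 4.1] -/
theorem galConj_complexConj_eq_inv {ψ : IdeleClassGroup L →ₜ* Circle} (hψ : IsConjugateSymplectic L ψ) :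
    galConj (IsCMField.complexConj L) ψ = ψ⁻¹ :=
  ContinuousMonoidHom.ext fun x => (isConjugateSelfDual_iff_galConj_eq_inv ψ).1 hψ.isConjugateSelfDual x

/-- **The inverse of a conjugate-symplectic character is conjugate symplectic** (`ψ⁻¹ = ψ^c`, [Liu2021, Rem. 4.4]). [cite: Liu2021, Remark 4.4] -/
theorem IsConjugateSymplectic.inv {ψ : IdeleClassGroup L →ₜ* Circle} (hψ : IsConjugateSymplectic L ψ) : IsConjugateSymplectic L ψ⁻¹ := by
  rw [← galConj_complexConj_eq_inv hψ]
  exact hψ.galConj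

/-- **The inverse of a conjugate-symplectic character of weight `𝔴` has weight `𝔴`** (`ψ⁻¹ = ψ^c` has ∞-type `−e`, same absolute weight).
[cite: Liu2021, Remark 4.4] [cite: Liu2021, Def. 4.3] -/
theorem HasWeight.inv {ψ : IdeleClassGroup L →ₜ* Circle} (hψ : IsConjugateSymplectic L ψ) {𝔴 : InfinitePlace L → ℕ}
    (hw : HasWeight L ψ 𝔴) : HasWeight L ψ⁻¹ 𝔴 := by
  rw [← galConj_complexConj_eq_inv hψ]
  exact hw.galConj_complexConj

omit [IsCMField L] in
/-- `(ψ⁻¹)⁻¹ = ψ`: the package-(B) flip is an involution on the label. [folklore] -/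
theorem inv_inv_eq (ψ : IdeleClassGroup L →ₜ* Circle) : ψ⁻¹⁻¹ = ψ := inv_inv ψ

end Summit.HodgeConjecture.HodgeConjecture.Cruxes.HLiu418.K2LiuConjugateSymplecticInv

end
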